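import Literature.Analysis.FluidPDE.NSVorticity
import HarnessLib

/-!
# Euler regularity controls slightly viscous Navier–Stokes (Constantin 1986, Thm. 1.1)

P. Constantin, *Note on loss of regularity for solutions of the 3-D incompressible Euler and
related equations*, Comm. Math. Phys. 104 (1986) 311–326, §1 "A comparison result", **Theorem 1.1**
(held text: the MRC Technical Summary Report #2884 version, `paper:doi-10-1007-bf01211598`,
pp. 4–7, read). In print:

"Let `v = v(t,x)` be a solution of (1.1) [`∂ₜv + (v·∇)v = −∇p + f`, `div v = 0`, `v(0,·) = v₀`,
in either `ℝ³` or `T³`] for `0 < t ≤ T`, satisfying (1.2) `|v₀|_{m+2} < ∞` for some `m ≥ 3`,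
(1.3) `∫₀ᵀ |∇ × v|_{L^∞} dt < ∞`. Then there exists `ν₀ = ν₀(T, |v₀|_{m+2}, f, ∫₀ᵀ |∇ × v|_{L^∞} dt)`
such that, for every `0 < ν ≤ ν₀` the solution to the Navier–Stokes equation (1.4)
[`∂ₜu + (u·∇)u = νΔu − ∇q + f`, `div u = 0`, `u(0,·) = v₀`] is smooth on `[0,T]`. More precisely
(1.5) `sup_{t ∈ [0,T]} |u(t) − v(t)|_m ≤ C ν` for some `C = γ_m` depending on
`T, |v₀|_{m+2}, f, ∫₀ᵀ |∇ × v|_{L^∞} dt`." (`|·|_m` the `H^m` norm; by Beale–Kato–Majda, (1.3)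
gives `v(t) ∈ H^{m+2}` on `[0,T]`, Thm. 1.2 loc. cit.; the proof is the `H^m` energy estimate
(1.10) for `w = u − v` and the ODE Lemma 1.3.)

Tree rendering (`constantin_small_viscosity`, a NAMED FACT, not proved here), on `ℝ³`, unforced
(`f = 0`), in the vocabulary of `ClassicalSolution.lean` / `NSVorticity.lean` / `NSWave0.lean`
exactly as used by route `NavierStokesRegularity/ReynoldsMonotone` (items `ConstantinSmallViscosity`,
`PreEulerRegularity`): the Euler solution is a classical solution `(U, P)` on `[0,T] × ℝ³`
(`IsClassicalEulerSolutionOn (Icc 0 T) 0 U P`) in the Beale–Kato–Majda class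
(`HasBoundedSobolevNormsOn (Icc 0 T) U`: all `H^n` seminorms bounded on `[0,T]`) from a rapidly
decaying datum (`HasRapidSpatialDecay (U 0)`). These hypotheses imply Constantin's (1.2)–(1.3) for
every `m` (`U 0 ∈ H^{m+2}`; `∇ × U ∈ L^∞` uniformly by Sobolev embedding), so the rendering is a
special case of the printed theorem combined with the standard local well-posedness/propagation of
`H^∞` regularity for Navier–Stokes (which turns "`sup_{[0,T]} |u(t)|_m < ∞`" into a classical
solution on `[0,T]` with all Sobolev norms bounded). Conclusion: `ν₀ > 0` and `C` (depending on
`m, T, U`) such that for `0 < ν ≤ ν₀` there is a classical Navier–Stokes solution `(u, p)` with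
viscosity `ν` on `[0,T] × ℝ³`, in the BKM class, with `u(0) = U(0)`, and
`‖Dⁿ(u(t) − U(t))‖_{L²} ≤ C ν` for all `t ∈ [0,T]`, `n ≤ m` (the `H^m` estimate (1.5), stated
seminorm by seminorm with the lower Lebesgue integral, as `HasBoundedSobolevNormsOn` does).

Deliberately NOT included (they are not in Thm. 1.1): continuation past `T`, a Leray–Hopf clause,
uniqueness of `u` — route item `ConstantinSmallViscosity` adds these from BKM / weak–strong
uniqueness. The torus case and forcing are omitted.

## References

* P. Constantin, Comm. Math. Phys. 104 (1986) 311–326, Thm. 1.1 (with Thm. 1.2 = Beale–Kato–Majda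
  and Lemma 1.3) [Constantin1986].
* J. T. Beale, T. Kato, A. Majda, Comm. Math. Phys. 94 (1984), Thm. 1 [BealeKatoMajda1984].
* T. Kato, *Nonstationary flows of viscous and ideal fluids in `ℝ³`*, J. Funct. Anal. 9 (1972)
  (Constantin's ref. [5]: local `H^m` theory and the vanishing-viscosity limit).
-/

noncomputable section

open MeasureTheory Set
open scoped ENNReal NNReal

namespace Literature.Analysis.FluidPDE

/-- **Constantin 1986, Thm. 1.1 (as long as Euler is smooth, slightly viscous Navier–Stokes is
smooth), `ℝ³`, unforced, tree rendering.** Let `m ≥ 3`, `T > 0`, and let `(U, P)` be a classical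
solution of the incompressible Euler equations on `[0,T] × ℝ³` whose Sobolev seminorms of all
orders are bounded on `[0,T]` (Beale–Kato–Majda class) and whose datum `U 0` decays rapidly.
Then there are `ν₀ > 0` and `C` (depending on `m`, `T`, `U`) such that for every viscosity
`0 < ν ≤ ν₀` there is a classical solution `(u, p)` of the Navier–Stokes equations with viscosity
`ν` on `[0,T] × ℝ³`, again in the Beale–Kato–Majda class, with the same datum `u 0 = U 0`, and
`∫ ‖Dⁿ(u(t) − U(t))‖² dx ≤ (C ν)²` for all `t ∈ [0,T]` and `n ≤ m` — printed:
"`ν₀ = ν₀(T, |v₀|_{m+2}, f, ∫₀ᵀ |∇×v|_∞ dt)` such that for every `0 < ν ≤ ν₀` the solution to the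
Navier–Stokes equation is smooth on `[0,T]`; more precisely `sup_{[0,T]} |u(t) − v(t)|_m ≤ C ν`".
See the module docstring for the translation of the hypotheses. [cite: Constantin1986, Thm. 1.1] -/
def constantin_small_viscosity : Prop :=
  ∀ m : ℕ, 3 ≤ m → ∀ T : ℝ, 0 < T → ∀ (U : ℝ → EuclideanSpace ℝ (Fin 3) → EuclideanSpace ℝ (Fin 3))
    (P : ℝ → EuclideanSpace ℝ (Fin 3) → ℝ),
    IsClassicalEulerSolutionOn (Icc 0 T) 0 U P → HasBoundedSobolevNormsOn (Icc 0 T) U →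
      HasRapidSpatialDecay (U 0) →
        ∃ ν₀ : ℝ, 0 < ν₀ ∧ ∃ C : ℝ, ∀ ν : ℝ, 0 < ν → ν ≤ ν₀ →
          ∃ (u : ℝ → EuclideanSpace ℝ (Fin 3) → EuclideanSpace ℝ (Fin 3))
            (p : ℝ → EuclideanSpace ℝ (Fin 3) → ℝ),
            IsClassicalNSSolutionOn (Icc 0 T) ν 0 u p ∧ HasBoundedSobolevNormsOn (Icc 0 T) u ∧
              u 0 = U 0 ∧
                ∀ t ∈ Icc 0 T, ∀ n ≤ m,
                  ∫⁻ x, ‖iteratedFDeriv ℝ n (u t - U t) x‖ₑ ^ 2 ≤ ENNReal.ofReal (C * ν) ^ 2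

/-- Constantin's theorem without the error estimate (the shape used by route
`NavierStokesRegularity/ReynoldsMonotone`): a BKM-class classical Euler solution on `[0,T]`
from a rapidly decaying datum has, for all small viscosities `0 < ν ≤ ν₀`, a BKM-class classical
Navier–Stokes solution on the same slab `[0,T]` with the same datum. Proved from
`constantin_small_viscosity` (take `m = 3`). [cite: Constantin1986, Thm. 1.1] -/
theorem constantin_small_viscosity.exists_classicalNS (h : constantin_small_viscosity)
    {T : ℝ} (hT : 0 < T) {U : ℝ → EuclideanSpace ℝ (Fin 3) → EuclideanSpace ℝ (Fin 3)}
    {P : ℝ → EuclideanSpace ℝ (Fin 3) → ℝ}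
    (hE : IsClassicalEulerSolutionOn (Icc 0 T) 0 U P) (hB : HasBoundedSobolevNormsOn (Icc 0 T) U)
    (hd : HasRapidSpatialDecay (U 0)) :
    ∃ ν₀ : ℝ, 0 < ν₀ ∧ ∀ ν : ℝ, 0 < ν → ν ≤ ν₀ →
      ∃ (u : ℝ → EuclideanSpace ℝ (Fin 3) → EuclideanSpace ℝ (Fin 3))
        (p : ℝ → EuclideanSpace ℝ (Fin 3) → ℝ),
        IsClassicalNSSolutionOn (Icc 0 T) ν 0 u p ∧ HasBoundedSobolevNormsOn (Icc 0 T) u ∧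
          u 0 = U 0 := by
  obtain ⟨ν₀, hν₀, C, hC⟩ := h 3 le_rfl T hT U P hE hB hd
  refine ⟨ν₀, hν₀, fun ν hν hνν₀ => ?_⟩
  obtain ⟨u, p, hu, hbu, h0, -⟩ := hC ν hν hνν₀
  exact ⟨u, p, hu, hbu, h0⟩

end Literature.Analysis.FluidPDE

end
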